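import Summits.ResolutionOfSingularities.ResolutionOfSingularities.Theorems.RadicialJungCleanModelsDimTwoOverField
import Summits.ResolutionOfSingularities.ResolutionOfSingularities.Theorems.RadicialJungCleanModelsDimTwoFFiniteClean
import Summits.ResolutionOfSingularities.ResolutionOfSingularities.Theorems.RadicialJungCleanModelsGiraudOverFieldDefs
import HarnessLib

/-!
# Route `RadicialJung`, crux `CleanModels`: the crux HOLDS IN DIMENSION 2 OVER EVERY FIELD,
# conditionally on Giraud's theorem over the field (PROGRAMME-clean-dim2 / T2 glue B9)

Route `ResolutionOfSingularities/RadicialJung`, crux item `CleanModels`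
(stmt-ResolutionOfSingularities-15917), line `via-clean-models` of crux `DescentPerfectToAll`
(stmt-0549), PROGRAMME-clean-dim2 (W8.1), T2 architecture brick B9
(`HOME/L/res-L0-w81-pv-2/g5/T2-ARCHITECTURE.md`). OURS; nothing here is a statement of Hironaka's
manuscript.

`cleanModels_dimTwo_of_giraudOverField`: the body of `CleanModels` for `W` of dimension `2` over an
ARBITRARY field `k` of characteristic `p`, granted the OURS statement "Giraud 1983 Thm. 2.4 with
Prop. 1.5 (ii) for integral regular surfaces locally of finite type over `k`, normal form at closed
points" (the T2 target `Giraud24OverField`, expanded here as the hypothesis `hG` — the def itself is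
filed separately as `RadicialJungCleanModelsGiraudOverFieldDefs.lean`). This is
`cleanModels_dimTwo_FFinite_of_giraud1983` (line `Sketch` rev 10, lead c2) with the `F`-finiteness
hypothesis `IsFFinite p 1 k` DELETED: Giraud's standing hypothesis "`Ω¹_X` of finite rank" was the
only consumer of `F`-finiteness in the chain (`stub_frobeniusStalkFiniteFlat`), and the T2 programme
replaces it by "locally of finite type over a field" (Ω-free rendering of Giraud's §§1–2:
`RadicialJungCleanModelsLogContentIdeal*.lean`, `Literature/…/GiraudLogJacobianIdeal.lean`). So the
dimension-2 case of the crux over the fields where `DescentPerfectToAll` actually lives (imperfect,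
NOT `F`-finite) now rests on ONE OURS statement with a kernel programme behind it, instead of on a
printed theorem whose hypothesis excludes those fields.
-/

noncomputable section

set_option linter.dupNamespace false -- mandated namespace of this single-conjunct summit

open CategoryTheory AlgebraicGeometry TopologicalSpace IsLocalRing
open Literature.AlgebraicGeometry.Resolution Literature.AlgebraicGeometry.Motives
open scoped TensorProduct

namespace Summit.ResolutionOfSingularities.ResolutionOfSingularities.Theorems.RadicialJung.CleanModels

/-- **`CleanModels` in dimension 2 over ANY field, granted Giraud's theorem over the field.** Let
`k` be a field of characteristic `p`, `W` a regular integral separated scheme of finite type over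
`k` with `dim W = 2` (`¬ dim W ≤ 1`, `dim W ≤ 2`), and `L/K(W)` purely inseparable of degree `p`.
If Giraud's Thm. 2.4 (with Prop. 1.5 (ii) at closed points) holds for integral regular surfaces
locally of finite type over `k` (`hG`, the T2 target `Giraud24OverField` instantiated at `p, k`),
then there are an integral `V` and a proper birational dominant `π : V → W` with `V` regular of
dimension `2` such that at EVERY point `v ∈ V` some `y ∈ L ∖ K(W)`, `y^p = g`, has `π^* g` exactly clean: toroidal
`∏_{i<m} t_i^{a_i}` along a minimal generating system of `𝔪_v` with all `p ∤ a_i`, or a unit `u₀`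
with `(∀ c, u₀ - c^p ∉ 𝔪_v) ∨ (∃ c, u₀ - c^p ∈ 𝔪_v ∖ 𝔪_v²)`.
[cite: Giraud1983, Thm. 2.4 and Prop. 1.5] -/
theorem cleanModels_dimTwo_of_giraudOverField (p : ℕ) (hp : p.Prime) (k : Type) [Field k]
    [CharP k p]
    (hG : ∀ (X : Scheme.{0}) [IsIntegral X] [CompactSpace X] (qX : X ⟶ Spec (.of k))
      [LocallyOfFiniteType qX],
      Scheme.IsRegular X → topologicalKrullDim X = 2 →
      ∀ f : Γ(X, ⊤),
        (∀ c : X.functionField, c ^ p ≠ (X.presheaf.germ ⊤ (genericPoint X) trivial) f) →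
      ∃ (X' : Scheme.{0}) (π : X' ⟶ X), IsProper π ∧ IsIntegral X' ∧ Scheme.IsRegular X' ∧
        (∃ U : X.Opens, ((U : Set X)ᶜ).Finite ∧ (∀ x ∈ (U : Set X)ᶜ, IsClosed ({x} : Set X)) ∧
          IsIso (π ∣_ U)) ∧
        ∀ x' : X', IsClosed ({x'} : Set X') → ∃ (d r : ℕ) (hrd : r ≤ d)
          (t : Fin d → X'.presheaf.stalk x')
          (g u : X'.presheaf.stalk x') (a : Fin r → ℕ),
          Ideal.span (Set.range t) = maximalIdeal (X'.presheaf.stalk x') ∧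
          ringKrullDim (X'.presheaf.stalk x') = (d : WithBot ℕ∞) ∧ (∀ i, 2 ≤ a i) ∧
          (X'.presheaf.germ ⊤ x' trivial) (π.appTop f) =
            g ^ p + u * ∏ i : Fin r, t (Fin.castLE hrd i) ^ a i ∧
          (((∃ i, ¬ p ∣ a i) ∧ IsUnit u) ∨
            LinearIndependent (ResidueField (X'.presheaf.stalk x'))
              (fun i => ((1 : ResidueField (X'.presheaf.stalk x')) ⊗ₜ[X'.presheaf.stalk x']
                (KaehlerDifferential.D ℤ (X'.presheaf.stalk x')
                  ((Fin.snoc (fun i : Fin r => t (Fin.castLE hrd i)) u :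
                    Fin (r + 1) → X'.presheaf.stalk x') i)) :
                ResidueField (X'.presheaf.stalk x') ⊗[X'.presheaf.stalk x']
                  (Ω[X'.presheaf.stalk x'⁄ℤ])))))
    (W : Scheme.{0}) [IsIntegral W]
    (f : W ⟶ Spec (.of k)) [IsSeparated f] [LocallyOfFiniteType f] [QuasiCompact f]
    (hW : Scheme.IsRegular W) (L : Type) [Field L] [Algebra W.functionField L]
    [IsPurelyInseparable W.functionField L] (hdeg : Module.finrank W.functionField L = p)
    (hdim₁ : ¬ topologicalKrullDim W ≤ 1) (hdim₂ : topologicalKrullDim W ≤ 2) :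
    ∃ (V : Scheme.{0}) (π : V ⟶ W) (_ : IsIntegral V) (_ : IsDominant π),
      IsProper π ∧ IsBirational π ∧ Scheme.IsRegular V ∧ topologicalKrullDim V = 2 ∧
      (∀ v : V, (∃ (y : L) (g : W.functionField), y ∉ Set.range (algebraMap W.functionField L) ∧
        algebraMap W.functionField L g = y ^ p ∧
        ((∃ (d m : ℕ) (hmd : m ≤ d) (t : Fin d → V.presheaf.stalk v) (a : Fin m → ℕ),
            Ideal.span (Set.range t) = maximalIdeal (V.presheaf.stalk v) ∧
            ringKrullDim (V.presheaf.stalk v) = (d : WithBot ℕ∞) ∧ 0 < m ∧ (∀ i, ¬ p ∣ a i) ∧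
            RatFn.functionFieldMap π g = ∏ i : Fin m,
              (algebraMap (V.presheaf.stalk v) V.functionField (t (Fin.castLE hmd i))) ^ (a i)) ∨
          (∃ u₀ : V.presheaf.stalk v, IsUnit u₀ ∧
            RatFn.functionFieldMap π g = algebraMap (V.presheaf.stalk v) V.functionField u₀ ∧
            ((∀ c : V.presheaf.stalk v, u₀ - c ^ p ∉ maximalIdeal (V.presheaf.stalk v)) ∨
              (∃ c : V.presheaf.stalk v, u₀ - c ^ p ∈ maximalIdeal (V.presheaf.stalk v) ∧
                u₀ - c ^ p ∉ maximalIdeal (V.presheaf.stalk v) ^ 2)))))) := by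
  haveI : Fact p.Prime := ⟨hp⟩
  haveI : CharP W.functionField p := charP_stalk W f _
  -- a generator `y₀`, `y₀^p = g₀ ∉ K(W)^p`
  obtain ⟨-, y₀, g₀, hy₀, hg₀, hg₀p⟩ := stub_generator (K := W.functionField) (L := L) p hp hdeg
  -- the loosely clean principalization at closed points, from Giraud's theorem
  obtain ⟨V', π', hV'int, hπ'dom, hπ'prop, hπ'bir, hV'reg, hdimV', halg⟩ :=
    principalizationDimTwo_of_giraudOverField p k hG W f hW
      (topologicalKrullDim_eq_two_of hdim₁ hdim₂) g₀ hg₀p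
  haveI := hV'int; haveI := hπ'dom; haveI := hπ'prop
  -- loosely clean at closed points, read in `L`
  have hclosed : ∀ v : V', IsClosed ({v} : Set V') → ∃ (y : L) (g : W.functionField),
      y ∉ Set.range (algebraMap W.functionField L) ∧ algebraMap W.functionField L g = y ^ p ∧
      ((∃ (d m : ℕ) (hmd : m ≤ d) (t : Fin d → V'.presheaf.stalk v) (a : Fin m → ℕ)
          (u : V'.presheaf.stalk v), IsUnit u ∧
          Ideal.span (Set.range t) = maximalIdeal (V'.presheaf.stalk v) ∧
          ringKrullDim (V'.presheaf.stalk v) = (d : WithBot ℕ∞) ∧ 0 < m ∧ (∀ i, ¬ p ∣ a i) ∧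
          RatFn.functionFieldMap π' g = algebraMap (V'.presheaf.stalk v) V'.functionField
            (u * ∏ i : Fin m, t (Fin.castLE hmd i) ^ (a i))) ∨
        (∃ u : V'.presheaf.stalk v, IsUnit u ∧
          RatFn.functionFieldMap π' g = algebraMap (V'.presheaf.stalk v) V'.functionField u ∧
          ∀ c : V'.presheaf.stalk v, u - c ^ p ∉ maximalIdeal (V'.presheaf.stalk v)) ∨
        (∃ s c : V'.presheaf.stalk v,
          RatFn.functionFieldMap π' g = algebraMap (V'.presheaf.stalk v) V'.functionField s ∧
          s - c ^ p ∈ maximalIdeal (V'.presheaf.stalk v) ∧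
          s - c ^ p ∉ maximalIdeal (V'.presheaf.stalk v) ^ 2)) := by
    intro v hv
    obtain ⟨c, ⟨j₀, hj₀, hc⟩, hloose⟩ := halg v hv
    obtain ⟨y, hy, hyp⟩ := stub_frobeniusTwist (K := W.functionField) (L := L) p hp y₀ g₀ hy₀ hg₀
      c j₀ hj₀ hc 1 one_ne_zero 0 (Nat.zero_le 1)
    refine ⟨y, ∑ j : Fin p, c j ^ p * g₀ ^ (j : ℕ), hy, ?_, hloose⟩
    rw [one_pow, one_mul, Nat.cast_zero, add_zero] at hyp
    exact hyp
  refine ⟨V', π', hV'int, hπ'dom, hπ'prop, hπ'bir, hV'reg, hdimV', fun v => ?_⟩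
  exact cleanModels_of_looseCleanAll p hp k W f L V' π' hπ'bir
    (looseCleanAll_of_closedPoints p hp k W f L V' π' hπ'bir hV'reg hclosed) v


/-- **`CleanModels` in dimension 2 over ANY field, granted the T2 target `Giraud24OverField`.**
The same statement with the hypothesis packaged as the OURS def `Giraud24OverField`
(`RadicialJungCleanModelsGiraudOverFieldDefs.lean`; Giraud's normal form `Giraud15NormalFormAt`
unfolds to the expanded form consumed above). [cite: Giraud1983, Thm. 2.4 and Prop. 1.5] -/
theorem cleanModels_dimTwo_of_giraud24OverField (hG : Giraud24OverField) (p : ℕ) (hp : p.Prime)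
    (k : Type) [Field k] [CharP k p] (W : Scheme.{0}) [IsIntegral W]
    (f : W ⟶ Spec (.of k)) [IsSeparated f] [LocallyOfFiniteType f] [QuasiCompact f]
    (hW : Scheme.IsRegular W) (L : Type) [Field L] [Algebra W.functionField L]
    [IsPurelyInseparable W.functionField L] (hdeg : Module.finrank W.functionField L = p)
    (hdim₁ : ¬ topologicalKrullDim W ≤ 1) (hdim₂ : topologicalKrullDim W ≤ 2) :
    ∃ (V : Scheme.{0}) (π : V ⟶ W) (_ : IsIntegral V) (_ : IsDominant π),
      IsProper π ∧ IsBirational π ∧ Scheme.IsRegular V ∧ topologicalKrullDim V = 2 ∧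
      (∀ v : V, (∃ (y : L) (g : W.functionField), y ∉ Set.range (algebraMap W.functionField L) ∧
        algebraMap W.functionField L g = y ^ p ∧
        ((∃ (d m : ℕ) (hmd : m ≤ d) (t : Fin d → V.presheaf.stalk v) (a : Fin m → ℕ),
            Ideal.span (Set.range t) = maximalIdeal (V.presheaf.stalk v) ∧
            ringKrullDim (V.presheaf.stalk v) = (d : WithBot ℕ∞) ∧ 0 < m ∧ (∀ i, ¬ p ∣ a i) ∧
            RatFn.functionFieldMap π g = ∏ i : Fin m,
              (algebraMap (V.presheaf.stalk v) V.functionField (t (Fin.castLE hmd i))) ^ (a i)) ∨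
          (∃ u₀ : V.presheaf.stalk v, IsUnit u₀ ∧
            RatFn.functionFieldMap π g = algebraMap (V.presheaf.stalk v) V.functionField u₀ ∧
            ((∀ c : V.presheaf.stalk v, u₀ - c ^ p ∉ maximalIdeal (V.presheaf.stalk v)) ∨
              (∃ c : V.presheaf.stalk v, u₀ - c ^ p ∈ maximalIdeal (V.presheaf.stalk v) ∧
                u₀ - c ^ p ∉ maximalIdeal (V.presheaf.stalk v) ^ 2)))))) := by
  haveI : Fact p.Prime := ⟨hp⟩
  exact cleanModels_dimTwo_of_giraudOverField p hp k
    (fun X _ _ qX _ hXreg hXdim g hg => hG p k X qX hXreg hXdim g hg) W f hW L hdeg hdim₁ hdim₂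

end Summit.ResolutionOfSingularities.ResolutionOfSingularities.Theorems.RadicialJung.CleanModels

end
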